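import Literature.MathematicalPhysics.QuantumFieldTheory.OSTimeContinuation
import Mathlib.Analysis.Calculus.ParametricIntegral
import HarnessLib

/-!
# The infinitesimal Euclidean rotation invariance of the Schwinger functions at Euclidean points

Support file (everything proved; no definitions, no named facts) for (B)
`Literature.MathematicalPhysics.QuantumFieldTheory.OS1973_lorentzInvariant_of_timeContinuation`
(`OSTimeContinuation`). Osterwalder–Schrader I (1973), §4.2, derive the Lorentz invariance of the
Wightman distributions from the *infinitesimal* form (4.15) of the Euclidean rotation
invariance E1 of the Schwinger functions, `Y_{0j} Sₙ = 0` with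
`Y_{0j} = ∑ₖ (x_k^j ∂/∂x_k⁰ − x_k⁰ ∂/∂x_k^j)` the generator of the rotations in the
`(0, j)`-plane acting on the difference-variable Schwinger functions. This file proves the
corresponding statement for the Euclidean restriction `x ↦ 𝔚(ιx)` of a function `𝔚` which is
merely *continuous* on the time-ordered Euclidean points (the setting of OS II, Thm. 4.3, where
`S_k(ζ⁰ | ξ⃗)` is continuous in `ξ⃗`), in the weak form in which no derivative falls on `𝔚`:

* `integral_euclideanPoint_mul_fderiv_rotGen_eq_zero` — if `𝔖ₙ` is Euclidean covariant (E1) and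
  `𝔖ₙ(F) = ∫ 𝔚(ιx) F(x) dx` on time-ordered test functions, then for every smooth `f` compactly
  supported in the time-ordered region `Ω_<` and every spatial direction `j`,
  `∫ 𝔚(ιx) · Df(x)(A x) dx = 0`, where `(A x)_k = x_k^j e₀ − x_k⁰ e_j` is the velocity field of
  the one-parameter group `R_θ = planeRot j θ` of Euclidean rotations in the `(0, j)`-plane
  (`hasDerivAt_planeRot_diag`).

Proof: for `θ` near `0` the rotated test function `f ∘ R_{−θ}` is still supported in `Ω_<`
(compactness of `tsupport f`, `IsCompact.eventually_forall_of_forall_eventually`), so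
`g(θ) = ∫ 𝔚(ιx) f(R_{−θ} x) dx = 𝔖ₙ(f ∘ R_θ⁻¹) = 𝔖ₙ(f)` by E1: `g` is constant near `0`. On the
other hand `g` may be differentiated under the integral sign
(`hasDerivAt_integral_of_dominated_loc_of_deriv_le`; the majorant is `sup |Df| · |𝔚 ∘ ι|` on the
compact set swept out by the rotated supports, which stays inside `Ω_<`), with
`d/dθ f(R_{−θ} x)|₀ = −Df(x)(A x)`.

## References

* K. Osterwalder, R. Schrader, *Axioms for Euclidean Green's functions*, Comm. Math. Phys. 31
  (1973) 83–112, §4.2, (4.2) and (4.15). [OsterwalderSchraderCMP1973]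
* K. Osterwalder, R. Schrader, *Axioms for Euclidean Green's functions II*, Comm. Math. Phys. 42
  (1975) 281–305, §IV.2 p. 288. [OsterwalderSchraderCMP1975]
-/

noncomputable section

open Filter Complex Set MeasureTheory Metric
open scoped Topology SchwartzMap ContDiff
open Literature.MathematicalPhysics.QuantumLattice

namespace Literature.MathematicalPhysics.QuantumFieldTheory

variable {d n : ℕ}

/-! ### The one-parameter group of plane rotations and its generator -/

/-- **The plane rotation written with `cos` and `sin`**: `R_θ y = cos θ · a(y) + sin θ · A(y) + (y − a(y))`
with `a(y) = y⁰ e₀ + y^j e_j` the projection to the `(0, j)`-plane and `A(y) = y^j e₀ − y⁰ e_j`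
the generator. [folklore] -/
theorem planeRot_apply_eq_cos_sin (j : Fin d) (θ : ℝ) (y : EuclideanSpace ℝ (Fin (d + 1))) :
    planeRot j θ y =
      Real.cos θ • ((y 0) • e₀ d + (y j.succ) • EuclideanSpace.single j.succ (1 : ℝ)) +
      Real.sin θ • ((y j.succ) • e₀ d - (y 0) • EuclideanSpace.single j.succ (1 : ℝ)) +
      (y - ((y 0) • e₀ d + (y j.succ) • EuclideanSpace.single j.succ (1 : ℝ))) := by
  have hne : (0 : Fin (d + 1)) ≠ j.succ := (Fin.succ_ne_zero j).symm
  ext i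
  simp only [planeRot_apply, PiLp.add_apply, PiLp.smul_apply, PiLp.sub_apply, e₀_apply,
    PiLp.single_apply, smul_eq_mul]
  by_cases h0 : i = 0
  · subst h0
    simp [hne]
  · by_cases hj : i = j.succ
    · subst hj
      simp [Fin.succ_ne_zero]
      ring
    · simp [h0, hj]

/-- The generator evaluated along the orbit: `cos θ · A(y) − sin θ · a(y) = A(R_θ y)`. [folklore] -/
theorem rotGen_planeRot (j : Fin d) (θ : ℝ) (y : EuclideanSpace ℝ (Fin (d + 1))) :
    Real.cos θ • ((y j.succ) • e₀ d - (y 0) • EuclideanSpace.single j.succ (1 : ℝ)) -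
      Real.sin θ • ((y 0) • e₀ d + (y j.succ) • EuclideanSpace.single j.succ (1 : ℝ)) =
      (planeRot j θ y j.succ) • e₀ d - (planeRot j θ y 0) • EuclideanSpace.single j.succ (1 : ℝ) := by
  have hne : (0 : Fin (d + 1)) ≠ j.succ := (Fin.succ_ne_zero j).symm
  ext i
  simp only [planeRot_apply, PiLp.add_apply, PiLp.smul_apply, PiLp.sub_apply, e₀_apply,
    PiLp.single_apply, smul_eq_mul, if_true, Fin.succ_ne_zero, if_false]
  by_cases h0 : i = 0
  · subst h0
    simp [hne]
    ring
  · by_cases hj : i = j.succ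
    · subst hj
      simp [Fin.succ_ne_zero]
      ring
    · simp [h0, hj]

/-- **The plane rotations form a differentiable one-parameter group with velocity field `A`**:
`d/dθ R_θ y = A(R_θ y)`, `A(y) = y^j e₀ − y⁰ e_j`. [folklore] -/
theorem hasDerivAt_planeRot (j : Fin d) (y : EuclideanSpace ℝ (Fin (d + 1))) (θ : ℝ) :
    HasDerivAt (fun θ : ℝ => planeRot j θ y)
      ((planeRot j θ y j.succ) • e₀ d - (planeRot j θ y 0) • EuclideanSpace.single j.succ (1 : ℝ)) θ := by
  have h : HasDerivAt (fun θ : ℝ =>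
      Real.cos θ • ((y 0) • e₀ d + (y j.succ) • EuclideanSpace.single j.succ (1 : ℝ)) +
      Real.sin θ • ((y j.succ) • e₀ d - (y 0) • EuclideanSpace.single j.succ (1 : ℝ)) +
      (y - ((y 0) • e₀ d + (y j.succ) • EuclideanSpace.single j.succ (1 : ℝ))))
      (-Real.sin θ • ((y 0) • e₀ d + (y j.succ) • EuclideanSpace.single j.succ (1 : ℝ)) +
        Real.cos θ • ((y j.succ) • e₀ d - (y 0) • EuclideanSpace.single j.succ (1 : ℝ)) + 0) θ :=
    (((Real.hasDerivAt_cos θ).smul_const _).add ((Real.hasDerivAt_sin θ).smul_const _)).add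
      (hasDerivAt_const θ _)
  have hfun : (fun θ : ℝ => planeRot j θ y) = fun θ : ℝ =>
      Real.cos θ • ((y 0) • e₀ d + (y j.succ) • EuclideanSpace.single j.succ (1 : ℝ)) +
      Real.sin θ • ((y j.succ) • e₀ d - (y 0) • EuclideanSpace.single j.succ (1 : ℝ)) +
      (y - ((y 0) • e₀ d + (y j.succ) • EuclideanSpace.single j.succ (1 : ℝ))) :=
    funext fun θ => planeRot_apply_eq_cos_sin j θ y
  rw [hfun]
  refine h.congr_deriv ?_
  rw [add_zero, neg_smul, neg_add_eq_sub, rotGen_planeRot]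

/-- The velocity of the inverse rotations: `d/dθ R_{−θ} y = −A(R_{−θ} y)`. [folklore] -/
theorem hasDerivAt_planeRot_neg (j : Fin d) (y : EuclideanSpace ℝ (Fin (d + 1))) (θ : ℝ) :
    HasDerivAt (fun θ : ℝ => planeRot j (-θ) y)
      (-((planeRot j (-θ) y j.succ) • e₀ d -
        (planeRot j (-θ) y 0) • EuclideanSpace.single j.succ (1 : ℝ))) θ := by
  have h : HasDerivAt (fun θ : ℝ => planeRot j (-θ) y) ((-1 : ℝ) • ((planeRot j (-θ) y j.succ) • e₀ d -
      (planeRot j (-θ) y 0) • EuclideanSpace.single j.succ (1 : ℝ))) θ :=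
    (hasDerivAt_planeRot j y (-θ)).scomp θ (hasDerivAt_neg θ)
  exact h.congr_deriv (neg_one_smul ℝ _)

/-- The velocity of the diagonal action on configurations: `d/dθ R_θ x = A(R_θ x)`. [folklore] -/
theorem hasDerivAt_planeRot_diag (j : Fin d) (x : Fin n → EuclideanSpace ℝ (Fin (d + 1))) (θ : ℝ) :
    HasDerivAt (fun θ : ℝ => fun k => planeRot j θ (x k))
      (fun k => (planeRot j θ (x k) j.succ) • e₀ d -
        (planeRot j θ (x k) 0) • EuclideanSpace.single j.succ (1 : ℝ)) θ :=
  hasDerivAt_pi.2 fun k => hasDerivAt_planeRot j (x k) θ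

/-- The velocity of the inverse diagonal action: `d/dθ R_{−θ} x = −A(R_{−θ} x)`. [folklore] -/
theorem hasDerivAt_planeRot_neg_diag (j : Fin d) (x : Fin n → EuclideanSpace ℝ (Fin (d + 1))) (θ : ℝ) :
    HasDerivAt (fun θ : ℝ => fun k => planeRot j (-θ) (x k))
      (fun k => -((planeRot j (-θ) (x k) j.succ) • e₀ d -
        (planeRot j (-θ) (x k) 0) • EuclideanSpace.single j.succ (1 : ℝ))) θ :=
  hasDerivAt_pi.2 fun k => hasDerivAt_planeRot_neg j (x k) θ

/-- The inverse of a plane rotation is the rotation by the opposite angle. [folklore] -/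
theorem planeRot_symm_apply (j : Fin d) (θ : ℝ) (y : EuclideanSpace ℝ (Fin (d + 1))) :
    (planeRot j θ).symm y = planeRot j (-θ) y := by
  apply (planeRot j θ).injective
  rw [LinearIsometryEquiv.apply_symm_apply]
  have h := planeRotLin_neg_apply_planeRotLin j (-θ) y
  rw [neg_neg] at h
  exact h.symm

/-- `R_θ (R_{−θ} y) = y`. [folklore] -/
theorem planeRot_apply_planeRot_neg (j : Fin d) (θ : ℝ) (y : EuclideanSpace ℝ (Fin (d + 1))) :
    planeRot j θ (planeRot j (-θ) y) = y := by
  have h := planeRotLin_neg_apply_planeRotLin j (-θ) y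
  rw [neg_neg] at h
  exact h

/-! ### The infinitesimal rotation invariance at Euclidean points -/

variable {S : SchwingerFamily (EuclideanSpace ℝ (Fin (d + 1)))} {𝔚 : (Fin n → Fin (d + 1) → ℂ) → ℂ}

/-- **Rotations near the identity keep a compact subset of `Ω_<` time-ordered**, uniformly. [folklore] -/
theorem eventually_forall_planeRot_mem_timeOrderedRegion (j : Fin d)
    {K : Set (Fin n → EuclideanSpace ℝ (Fin (d + 1)))} (hK : IsCompact K)
    (hKΩ : K ⊆ timeOrderedRegion d n) :
    ∀ᶠ θ in 𝓝 (0 : ℝ), ∀ y ∈ K, (fun k => planeRot j θ (y k)) ∈ timeOrderedRegion d n := by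
  refine hK.eventually_forall_of_forall_eventually fun y hy => ?_
  have hc := (continuous_planeRot_diag (n := n) j).continuousAt (x := ((0 : ℝ), y))
  refine hc.eventually_mem (isOpen_timeOrderedRegion.mem_nhds ?_)
  have h0 : (fun k => planeRot j (0 : ℝ) (y k)) = y := funext fun k => planeRot_zero_apply j (y k)
  simpa only [h0] using hKΩ hy

/-- **Infinitesimal Euclidean rotation invariance at Euclidean points, weak form** (Osterwalder–
Schrader I (1973), (4.15), for the Euclidean restriction of a function continuous on the
time-ordered Euclidean points): under E1 and the Euclidean formula, for every smooth `f`
compactly supported in `Ω_<` and every spatial direction `j`,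
`∫ 𝔚(ιx) · Df(x)(A x) dx = 0` with `(A x)_k = x_k^j e₀ − x_k⁰ e_j`. [cite: OsterwalderSchraderCMP1973, §4.2 eq. (4.15)] -/
theorem integral_euclideanPoint_mul_fderiv_rotGen_eq_zero (hE1 : S.IsEuclideanCovariant)
    (hcont : ContinuousOn (fun x => 𝔚 (euclideanPoint x)) (timeOrderedRegion d n))
    (hS : ∀ F : 𝓢((Fin n → EuclideanSpace ℝ (Fin (d + 1))), ℂ), IsTimeOrdered F →
      S n F = ∫ x, 𝔚 (euclideanPoint x) * F x)
    (j : Fin d) {f : (Fin n → EuclideanSpace ℝ (Fin (d + 1))) → ℂ} (hf : ContDiff ℝ ∞ f)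
    (hfc : HasCompactSupport f) (hfs : tsupport f ⊆ timeOrderedRegion d n) :
    ∫ x, 𝔚 (euclideanPoint x) * fderiv ℝ f x (fun k => (x k j.succ) • e₀ d -
      (x k 0) • EuclideanSpace.single j.succ (1 : ℝ)) = 0 := by
  -- notation: the generator on configurations and the rotated configurations
  let A : (Fin n → EuclideanSpace ℝ (Fin (d + 1))) → (Fin n → EuclideanSpace ℝ (Fin (d + 1))) :=
    fun x k => (x k j.succ) • e₀ d - (x k 0) • EuclideanSpace.single j.succ (1 : ℝ)
  let ρ : ℝ → (Fin n → EuclideanSpace ℝ (Fin (d + 1))) → (Fin n → EuclideanSpace ℝ (Fin (d + 1))) :=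
    fun θ x k => planeRot j θ (x k)
  have hρc : Continuous fun p : ℝ × (Fin n → EuclideanSpace ℝ (Fin (d + 1))) => ρ p.1 p.2 :=
    continuous_planeRot_diag j
  have hρθ : ∀ θ, Continuous (ρ θ) := fun θ =>
    continuous_pi fun k => (planeRot j θ).continuous.comp (continuous_apply k)
  have hρρ : ∀ θ x, ρ θ (ρ (-θ) x) = x := fun θ x => funext fun k => planeRot_apply_planeRot_neg j θ (x k)
  have hρρ' : ∀ θ x, ρ (-θ) (ρ θ x) = x := fun θ x => by
    have := hρρ (-θ) x; rwa [neg_neg] at this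
  have hAc : Continuous A := by
    refine continuous_pi fun k => ?_
    have h1 : Continuous fun x : Fin n → EuclideanSpace ℝ (Fin (d + 1)) => x k j.succ :=
      (EuclideanSpace.proj j.succ).continuous.comp (continuous_apply k)
    have h2 : Continuous fun x : Fin n → EuclideanSpace ℝ (Fin (d + 1)) => x k 0 :=
      (EuclideanSpace.proj 0).continuous.comp (continuous_apply k)
    exact (h1.smul continuous_const).sub (h2.smul continuous_const)
  have hf1 : Differentiable ℝ f := hf.differentiable (by simp)
  have hfd : Continuous (fderiv ℝ f) := hf.continuous_fderiv (by simp)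
  -- (a) small rotations keep the support time-ordered
  obtain ⟨ε, hε, hεΩ⟩ : ∃ ε > 0, ∀ θ : ℝ, |θ| < ε → ∀ y ∈ tsupport f, ρ θ y ∈ timeOrderedRegion d n := by
    have h := eventually_forall_planeRot_mem_timeOrderedRegion j hfc.isCompact hfs
    obtain ⟨ε, hε, h⟩ := Metric.eventually_nhds_iff.1 h
    exact ⟨ε, hε, fun θ hθ => h (by simpa [Real.dist_eq] using hθ)⟩
  -- supports of the rotated test functions
  have hsupp : ∀ θ : ℝ, |θ| < ε → tsupport (fun x => f (ρ (-θ) x)) ⊆ timeOrderedRegion d n := by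
    intro θ hθ x hx
    have hx' : ρ (-θ) x ∈ tsupport f := by
      have hcomp : (fun x => f (ρ (-θ) x)) = f ∘ ρ (-θ) := rfl
      rw [hcomp] at hx
      exact tsupport_comp_subset_preimage f (hρθ (-θ)) hx
    have := hεΩ θ hθ _ hx'
    rwa [hρρ] at this
  -- (b) the rotated integrals are constant: E1
  let fS : 𝓢((Fin n → EuclideanSpace ℝ (Fin (d + 1))), ℂ) := hfc.toSchwartzMap hf
  have hfSap : ∀ x, fS x = f x := fun x => rfl
  let F : ℝ → (Fin n → EuclideanSpace ℝ (Fin (d + 1))) → ℂ :=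
    fun θ x => 𝔚 (euclideanPoint x) * f (ρ (-θ) x)
  let g : ℝ → ℂ := fun θ => ∫ x, F θ x
  have hgconst : ∀ θ : ℝ, |θ| < ε → g θ = S n fS := by
    intro θ hθ
    have hlin : ∀ x, linActMulti (planeRot j θ) fS x = f (ρ (-θ) x) := fun x => by
      rw [linActMulti_apply, hfSap]
      simp only [ρ, planeRot_symm_apply]
    have hto : IsTimeOrdered (linActMulti (planeRot j θ) fS) := by
      intro x hx
      have heq : ((linActMulti (planeRot j θ) fS : 𝓢(_, ℂ)) : (Fin n → EuclideanSpace ℝ (Fin (d + 1))) → ℂ) =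
          fun x => f (ρ (-θ) x) := funext hlin
      rw [heq] at hx
      exact hsupp θ hθ hx
    calc g θ = ∫ x, 𝔚 (euclideanPoint x) * linActMulti (planeRot j θ) fS x := by
          simp only [g, F, hlin]
      _ = S n (linActMulti (planeRot j θ) fS) := (hS _ hto).symm
      _ = S n fS := hE1.linActMulti n _ fS
  have hg0 : HasDerivAt g 0 0 := by
    refine (hasDerivAt_const (0 : ℝ) (S n fS)).congr_of_eventuallyEq ?_
    filter_upwards [Metric.ball_mem_nhds (0 : ℝ) hε] with θ hθ
    exact hgconst θ (by simpa [Real.dist_eq] using hθ)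
  -- (c) differentiation under the integral sign
  let F' : ℝ → (Fin n → EuclideanSpace ℝ (Fin (d + 1))) → ℂ :=
    fun θ x => 𝔚 (euclideanPoint x) * fderiv ℝ f (ρ (-θ) x) (-(A (ρ (-θ) x)))
  -- the compact set swept out by the rotated supports
  let K : Set (Fin n → EuclideanSpace ℝ (Fin (d + 1))) :=
    (fun p : ℝ × (Fin n → EuclideanSpace ℝ (Fin (d + 1))) => ρ p.1 p.2) ''
      (closedBall (0 : ℝ) (ε / 2) ×ˢ tsupport f)
  have hKc : IsCompact K := ((isCompact_closedBall _ _).prod hfc.isCompact).image hρc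
  have hKΩ : K ⊆ timeOrderedRegion d n := by
    rintro _ ⟨⟨θ, y⟩, ⟨hθ, hy⟩, rfl⟩
    refine hεΩ θ ?_ y hy
    have : |θ| ≤ ε / 2 := by simpa [Real.dist_eq] using hθ
    linarith
  have hmemK : ∀ θ ∈ ball (0 : ℝ) (ε / 2), ∀ x, ρ (-θ) x ∈ tsupport f → x ∈ K := by
    intro θ hθ x hx
    refine ⟨(θ, ρ (-θ) x), ⟨mem_closedBall.2 (mem_ball.1 hθ).le, hx⟩, ?_⟩
    exact hρρ θ x
  -- bounds
  obtain ⟨C₁, hC₁⟩ := hfd.bounded_above_of_compact_support (hfc.fderiv ℝ)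
  obtain ⟨C₂', hC₂'⟩ := hfc.isCompact.exists_bound_of_continuousOn (f := A) hAc.continuousOn
  let C₂ : ℝ := max C₂' 0
  have hC₂ : ∀ y ∈ tsupport f, ‖A y‖ ≤ C₂ := fun y hy => (hC₂' y hy).trans (le_max_left _ _)
  have hC₂0 : 0 ≤ C₂ := le_max_right _ _
  have hC₁0 : 0 ≤ C₁ := (norm_nonneg _).trans (hC₁ 0)
  let bound : (Fin n → EuclideanSpace ℝ (Fin (d + 1))) → ℝ :=
    K.indicator fun x => C₁ * C₂ * ‖𝔚 (euclideanPoint x)‖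
  have hbound_int : Integrable bound := by
    rw [integrable_indicator_iff hKc.measurableSet]
    have hci : ContinuousOn (fun x => C₁ * C₂ * ‖𝔚 (euclideanPoint x)‖) K :=
      continuousOn_const.mul (hcont.mono hKΩ).norm
    exact hci.integrableOn_compact hKc
  have hF'le : ∀ x, ∀ θ ∈ ball (0 : ℝ) (ε / 2), ‖F' θ x‖ ≤ bound x := by
    intro x θ hθ
    by_cases hx : ρ (-θ) x ∈ tsupport f
    · have hxK : x ∈ K := hmemK θ hθ x hx
      simp only [bound, F']
      rw [indicator_of_mem hxK, norm_mul, mul_comm]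
      refine mul_le_mul_of_nonneg_right ?_ (norm_nonneg _)
      calc ‖fderiv ℝ f (ρ (-θ) x) (-(A (ρ (-θ) x)))‖
          ≤ ‖fderiv ℝ f (ρ (-θ) x)‖ * ‖-(A (ρ (-θ) x))‖ := ContinuousLinearMap.le_opNorm _ _
        _ ≤ C₁ * C₂ := by
            rw [norm_neg]
            exact mul_le_mul (hC₁ _) (hC₂ _ hx) (norm_nonneg _) hC₁0
    · have h0 : fderiv ℝ f (ρ (-θ) x) = 0 := fderiv_of_notMem_tsupport ℝ hx
      have hb0 : 0 ≤ bound x := by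
        refine Set.indicator_nonneg (fun y _ => ?_) x
        exact mul_nonneg (mul_nonneg hC₁0 hC₂0) (norm_nonneg _)
      simp [F', h0, hb0]
  -- measurability and integrability
  have hcontF : ∀ θ : ℝ, |θ| < ε → Continuous (F θ) := fun θ hθ =>
    continuous_mul_of_tsupport_subset isOpen_timeOrderedRegion hcont
      (hf.continuous.comp (hρθ (-θ))) (hsupp θ hθ)
  have hF_meas : ∀ᶠ θ in 𝓝 (0 : ℝ), AEStronglyMeasurable (F θ) volume := by
    filter_upwards [Metric.ball_mem_nhds (0 : ℝ) hε] with θ hθ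
    exact (hcontF θ (by simpa [Real.dist_eq] using hθ)).aestronglyMeasurable
  have hF0 : F 0 = fun x => 𝔚 (euclideanPoint x) * f x := by
    funext x
    simp only [F, ρ, neg_zero, planeRot_zero_apply]
  have hF_int : Integrable (F 0) := by
    refine (hcontF 0 (by simpa using hε)).integrable_of_hasCompactSupport ?_
    rw [hF0]
    exact hfc.mul_left
  have hF'0 : F' 0 = fun x => 𝔚 (euclideanPoint x) * fderiv ℝ f x (-(A x)) := by
    funext x
    simp only [F', ρ, neg_zero, planeRot_zero_apply]
  have hF'_meas : AEStronglyMeasurable (F' 0) volume := by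
    rw [hF'0]
    have h1 : Continuous fun x : Fin n → EuclideanSpace ℝ (Fin (d + 1)) => fderiv ℝ f x (-(A x)) :=
      hfd.clm_apply hAc.neg
    refine (continuous_mul_of_tsupport_subset isOpen_timeOrderedRegion hcont h1 ?_).aestronglyMeasurable
    refine (closure_mono ?_).trans ((tsupport_fderiv_subset ℝ (f := f)).trans hfs)
    intro x hx
    rw [Function.mem_support] at hx ⊢
    intro h0
    exact hx (by simp [h0])
  have h_diff : ∀ x, ∀ θ ∈ ball (0 : ℝ) (ε / 2), HasDerivAt (fun θ => F θ x) (F' θ x) θ := by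
    intro x θ _
    have hρd := hasDerivAt_planeRot_neg_diag j x θ
    have hfx : HasFDerivAt f (fderiv ℝ f (ρ (-θ) x)) (ρ (-θ) x) := (hf1 _).hasFDerivAt
    have hcomp := (hfx.comp_hasDerivAt θ hρd).const_mul (𝔚 (euclideanPoint x))
    exact hcomp
  have hmain := (hasDerivAt_integral_of_dominated_loc_of_deriv_le
    (Metric.ball_mem_nhds (0 : ℝ) (half_pos hε)) hF_meas hF_int hF'_meas
    (Eventually.of_forall hF'le) hbound_int (Eventually.of_forall h_diff)).2
  have hzero : (∫ x, F' 0 x) = 0 := hmain.unique hg0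
  rw [hF'0] at hzero
  simpa [mul_neg, integral_neg] using hzero

end Literature.MathematicalPhysics.QuantumFieldTheory
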